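import Summits.BirchSwinnertonDyer.BirchSwinnertonDyer.Theorems.PrintCf2DisegniPairTwoFrameCore
import HarnessLib

/-!
# Road (C) `disegni-pair-two` on crux stmt-BirchSwinnertonDyer-20368 — FRAME CORE, K-FIXING form (referee F1 / item 27325)

LEAD `bsd-line-cf2-p1` g21, for the registered stub `stub_frame_two` of `Lines/disegni_pair_two.lean` (v3). The
class-independent part of the Disegni pair frame of a member `W` (`C₀ • W = 49a1^{(d* d′)}`, `d′ ≡ 1 (4)` squarefree,
`d* ∈ {2, −1, −2}`, `r_an(W) = 1`), assembled from the FIELDS / CURVES / HEEGNER / Mordell–Weil pieces: the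
Friedberg–Hoffstein field `K` (`2` split, `𝔭 ≠ 𝔭′`), its Kronecker character `κ`, the good partner `V = W_k` and its
odd twist `V′ ≅ V^{(d_K)}` (globally minimal, ordinary at `2`, `a₂` equal), the newforms `f, f′, g, g′` with the
coefficientwise identities `a(f′) = κ·a(f)`, `a(g) = χ_{d*}·a(f)`, `a(g′) = χ_{d*}·a(f′)` (`χ_{d*}(m) = (d*/m)` for odd
`m`, `0` for even `m`), the companion `W′ = W^{(d_K)}` with `L(W′,1) ≠ 0`, `L(W,1) = 0`, the tower `H = K(√d*)` with
its sign character, `u = √d_K`, the conjugation, the member's model `C • W = V^{(d*)}`, a generator modulo torsion,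
the torsion of the companion twist, and a modular parametrisation datum of `V` — AS `frame_core` (file `…FrameCore.lean`)
PLUS two outputs the ticket twin `PrintCf2.SplitBadTwoDisegniGZPairOfFacts` (stmt-BirchSwinnertonDyer-27325, referee F1)
consumes: «every `σ ∈ G` fixes `K` pointwise» (`G = Gal(H/K)`) and «`V` has good reduction at the primes of `d_K`» (input of
the base-change minimality of `V ⊗ H`) (`frame_core_fixing`). THEOREMS ONLY; no `sorry`; no new definitions. BSD is not
proved by any of this; 20368 is not closed here.
-/

set_option linter.dupNamespace false

noncomputable section

open scoped Classical MatrixGroups ModularForm NumberField NumberTheorySymbols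

open CongruenceSubgroup NumberField IsDedekindDomain WeierstrassCurve WeierstrassCurve.Affine.Point
  Literature.NumberTheory.EllipticCurves Literature.NumberTheory.EllipticCurves.ModularForms

namespace Summit.BirchSwinnertonDyer.BirchSwinnertonDyer.Theorems.PrintCf2.DisegniPairTwo

set_option maxHeartbeats 800000 in
/-- ★★ **THE DISEGNI PAIR FRAME — CORE, `K`-FIXING FORM (class-independent part), for `d* ∈ {2, −1, −2}`.** As `frame_core`, plus:
`G` fixes `K` pointwise, and `V` is good at the primes of `d_K`. See the module docstring.
Inputs: the S0′ prints (modularity continuation, newform existence, parametrisation datum, Friedberg–Hoffstein) and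
GZK (`rank = r_an` for `r_an ≤ 1`). [cite: FriedbergHoffstein1995, main theorem] [cite: SilvermanAEC2009, X.2 and X.5]
[cite: Disegni2017, §1.1.1 (arXiv v3 PDF p. 3)] [cite: GrossZagier1986, Thm. I.(7.3)] -/
theorem frame_core_fixing (hmod : hasEntireLFunction_rat) (hnew : exists_isNewformOf)
    (hnp : nonempty_modularParametrizationData) (hFH : friedbergHoffstein_exists_heegnerField_split_twist_ne_zero)
    (hrank : rank_eq_analyticRank_of_analyticRank_le_one)
    {ds d' d : ℤ} (hds : ds = 2 ∨ ds = -1 ∨ ds = -2) (hd4 : d' % 4 = 1) (hsq : Squarefree d') (hd : d = ds * d')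
    (W : WeierstrassCurve ℚ) [W.IsElliptic] [W.IsGloballyMinimal] (C₀ : VariableChange ℚ)
    (hC₀ : C₀ • W = cm7.quadraticTwist (d : ℚ)) (hr : W.analyticRank = 1) :
    ∃ (K : Type) (_ : Field K) (_ : NumberField K) (_ : IsGalois ℚ K),
      IsImaginaryQuadratic K ∧ Module.finrank ℚ K = 2 ∧
      ((Ideal.span {(2 : ℤ)}).primesOver (𝓞 K)).ncard = 2 ∧
    ∃ (𝔭 𝔭' : HeightOneSpectrum (𝓞 K)), ((2 : ℕ) : 𝓞 K) ∈ 𝔭.asIdeal ∧ ((2 : ℕ) : 𝓞 K) ∈ 𝔭'.asIdeal ∧ 𝔭 ≠ 𝔭' ∧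
    ∃ (κ : DirichletCharacter ℂ (NumberField.discr K).natAbs),
      (∀ ℓ : ℕ, ℓ.Prime → ℓ ≠ 2 → κ ℓ = (jacobiSym (NumberField.discr K) ℓ : ℂ)) ∧
      (κ 2 = if NumberField.discr K % 8 = 1 then 1 else if NumberField.discr K % 8 = 5 then -1 else 0) ∧
      Nat.Coprime 2 (NumberField.discr K).natAbs ∧
    ∃ (k : ℤ) (V V' : WeierstrassCurve ℚ) (_ : V.IsElliptic) (_ : V.IsGloballyMinimal) (_ : V'.IsElliptic)
      (_ : V'.IsGloballyMinimal) (C₁ : VariableChange ℚ),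
      V = ⟨1, -(3 * (k : ℚ) + 1), 0, -2 * (4 * (k : ℚ) + 1) ^ 2, -(4 * (k : ℚ) + 1) ^ 3⟩ ∧ d' = 4 * k + 1 ∧
      C₁ • V = cm7.quadraticTwist (d' : ℚ) ∧ IsOrdinaryAt V 2 ∧ IsOrdinaryAt V' 2 ∧
      V'.frobeniusTrace 2 = V.frobeniusTrace 2 ∧
      (∀ v : HeightOneSpectrum (𝓞 ℚ), ((Rat.HeightOneSpectrum.primesEquiv v : ℕ) : ℤ) ∣ NumberField.discr K →
        V.HasGoodReductionAt v) ∧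
    ∃ (N N' : ℕ) (_ : NeZero N) (_ : NeZero N') (f : CuspForm (Gamma0 N) 2) (f' : CuspForm (Gamma0 N') 2),
      IsNewformOf V f ∧ IsNewformOf V' f' ∧ (∀ n : ℕ, cuspCoeff f' n = κ (n : ZMod _) * cuspCoeff f n) ∧
      Nonempty (ModularParametrizationData V N) ∧
    ∃ (M M' : ℕ) (_ : NeZero M) (_ : NeZero M') (g : CuspForm (Gamma0 M) 2) (g' : CuspForm (Gamma0 M') 2)
      (W' : WeierstrassCurve ℚ) (_ : W'.IsElliptic),
      IsNewformOf W g ∧ IsNewformOf W' g' ∧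
      (∀ m : ℕ, cuspCoeff g m = (((if Even m then 0 else J(ds | m) : ℤ)) : ℂ) * cuspCoeff f m) ∧
      (∀ m : ℕ, cuspCoeff g' m = (((if Even m then 0 else J(ds | m) : ℤ)) : ℂ) * cuspCoeff f' m) ∧
      W'.entireLFunction 1 ≠ 0 ∧ W.entireLFunction 1 = 0 ∧
    ∃ (H : Type) (_ : Field H) (_ : NumberField H) (_ : Algebra K H) (_ : Module.finrank K H = 2) (t : H)
      (_ : t ∉ Set.range (algebraMap K H)) (_ : t ^ 2 = algebraMap ℚ H (ds : ℚ))
      (G : Subgroup (H ≃ₐ[ℚ] H)) (χ : G →* ℂˣ) (s : G → ℤ) (_ : ∀ σ, ((χ σ : ℂˣ) : ℂ) = (s σ : ℂ))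
      (_ : ∀ (σ : G) (a : K), σ.1 (algebraMap K H a) = algebraMap K H a)
      (τ : H ≃ₐ[ℚ] H) (hτG : τ ∈ G), s ⟨τ, hτG⟩ = -1 ∧ (∀ a : K, τ (algebraMap K H a) = algebraMap K H a) ∧
      τ t = -t ∧
    ∃ (u : K) (e : ℚ), u ∉ Set.range (algebraMap ℚ K) ∧ u ^ 2 = algebraMap ℚ K e ∧
    ∃ (c : K ≃ₐ[ℚ] K), c u = -u ∧
    ∃ (_ : (V.quadraticTwist (ds : ℚ)).IsElliptic) (C : VariableChange ℚ), C • W = V.quadraticTwist (ds : ℚ) ∧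
    ∃ (P : (V.quadraticTwist (ds : ℚ)).toAffine.Point), ¬ IsOfFinAddOrder P ∧
      (∀ R : (V.quadraticTwist (ds : ℚ)).toAffine.Point,
        ∃ (n : ℤ) (T : (V.quadraticTwist (ds : ℚ)).toAffine.Point), IsOfFinAddOrder T ∧ R = n • P + T) ∧
      (∀ Q : ((V.quadraticTwist (ds : ℚ)).quadraticTwist e).toAffine.Point, IsOfFinAddOrder Q) := by
  haveI : Fact (2 : ℕ).Prime := ⟨Nat.prime_two⟩
  -- §A the good partner and the member's model
  have hC₀' : C₀ • W = cm7.quadraticTwist (((ds * d' : ℤ)) : ℚ) := by rw [hC₀, hd]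
  obtain ⟨k, V, hk, hV, hVell, hVmin, ⟨C₁, hC₁⟩, C, hC⟩ := exists_goodPartner_model hd4 hsq W C₀ hC₀'
  haveI := hVell
  haveI := hVmin
  subst hk
  have hds0 : ds ≠ 0 := by rcases hds with rfl | rfl | rfl <;> decide
  have hdsQ : (ds : ℚ) ≠ 0 := Int.cast_ne_zero.mpr hds0
  haveI hVds : (V.quadraticTwist (ds : ℚ)).IsElliptic := V.isElliptic_quadraticTwist hdsQ
  have hordV : IsOrdinaryAt V 2 := isOrdinaryAt_two_of_cm7_quadraticTwist hd4 V C₁ hC₁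
  -- §B the Friedberg–Hoffstein field
  obtain ⟨K, hKf, hKn, hKg, hK, h2K, hsplit, ⟨𝔭, 𝔭', h𝔭, h𝔭', hne⟩, h8, hsqD, hDneg, hgoodW, hL'⟩ :=
    exists_heegnerField hnew hFH W hr
  obtain ⟨κ, hκ, hκ2, hcop, hκn⟩ := exists_kroneckerChar K h8
  have hD0 : NumberField.discr K ≠ 0 := hDneg.ne
  have hD0Q : ((NumberField.discr K : ℤ) : ℚ) ≠ 0 := Int.cast_ne_zero.mpr hD0
  have hD4 : NumberField.discr K % 4 = 1 := by omega
  -- `V` is good at the (odd, ramified) primes of `d_K`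
  have hgoodV : ∀ v : HeightOneSpectrum (𝓞 ℚ), ((Rat.HeightOneSpectrum.primesEquiv v : ℕ) : ℤ) ∣ NumberField.discr K →
      V.HasGoodReductionAt v := by
    intro v hv
    refine hasGoodReductionAt_partner_of_member V k hV hsq hC₁ hds hC v (fun h2 => ?_) (hgoodW v hv)
    rw [h2] at hv
    have : (2 : ℤ) ∣ NumberField.discr K := by exact_mod_cast hv
    omega
  -- §C the odd twist `V′ ≅ V^{(d_K)}`, globally minimal, ordinary at `2`, `a₂` equal
  haveI hVD : (V.quadraticTwist ((NumberField.discr K : ℤ) : ℚ)).IsElliptic := V.isElliptic_quadraticTwist hD0Q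
  obtain ⟨V', hV'ell, hV'min, C', hC'⟩ : ∃ (V' : WeierstrassCurve ℚ) (_ : V'.IsElliptic) (_ : V'.IsGloballyMinimal)
      (C' : VariableChange ℚ), C' • V' = V.quadraticTwist ((NumberField.discr K : ℤ) : ℚ) := by
    obtain ⟨C', hC'min⟩ := hasGlobalMinimalModel_rat_holds (V.quadraticTwist ((NumberField.discr K : ℤ) : ℚ))
    exact ⟨C' • V.quadraticTwist ((NumberField.discr K : ℤ) : ℚ), inferInstance, hC'min, C'⁻¹, inv_smul_smul C' _⟩
  haveI := hV'ell
  haveI := hV'min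
  have hmodel' : ((⟨C₁.u, ((NumberField.discr K : ℤ) : ℚ) * C₁.r, 0, 0⟩ : VariableChange ℚ) * C') • V' =
      cm7.quadraticTwist ((((4 * k + 1) * NumberField.discr K : ℤ)) : ℚ) := by
    rw [mul_smul, hC', show ((((4 * k + 1) * NumberField.discr K : ℤ)) : ℚ) =
      (((4 * k + 1 : ℤ)) : ℚ) * ((NumberField.discr K : ℤ) : ℚ) by push_cast; ring, ← quadraticTwist_quadraticTwist,
      ← hC₁, quadraticTwist_smul]
  have hd4' : ((4 * k + 1) * NumberField.discr K) % 4 = 1 := by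
    rw [Int.mul_emod, hd4, hD4]; norm_num
  have hordV' : IsOrdinaryAt V' 2 := isOrdinaryAt_two_of_cm7_quadraticTwist hd4' V' _ hmodel'
  have hap : V'.frobeniusTrace 2 = V.frobeniusTrace 2 :=
    frobeniusTrace_two_partnerTwist_eq V h8 hsqD hgoodV hordV.1 hC' hordV'.1
  -- §D newforms and coefficient identities
  haveI hVN : NeZero (V.conductorNorm ℤ) := ⟨(conductorNorm_pos_holds V).ne'⟩
  haveI hV'N : NeZero (V'.conductorNorm ℤ) := ⟨(conductorNorm_pos_holds V').ne'⟩
  haveI hWN : NeZero (W.conductorNorm ℤ) := ⟨(conductorNorm_pos_holds W).ne'⟩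
  obtain ⟨f, hf⟩ := hnew V
  obtain ⟨f', hf'⟩ := hnew V'
  have hLV' : ∀ n : ℕ, V'.LFunction n = J((n : ℤ) | (NumberField.discr K).natAbs) * V.LFunction n :=
    LFunction_partnerTwist_eq V hD4 hsqD hgoodV hC'
  have hV'coef : ∀ n : ℕ, cuspCoeff f' n = κ (n : ZMod _) * cuspCoeff f n := fun n => by
    rw [hf'.2 n, hf.2 n, hκn n, hLV' n, Int.cast_mul]
  obtain ⟨W', hW'def⟩ : ∃ W' : WeierstrassCurve ℚ, W' = W.quadraticTwist ((NumberField.discr K : ℤ) : ℚ) := ⟨_, rfl⟩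
  haveI hW'ell : W'.IsElliptic := by rw [hW'def]; exact W.isElliptic_quadraticTwist hD0Q
  haveI hW'N : NeZero (W'.conductorNorm ℤ) := ⟨(conductorNorm_pos_holds W').ne'⟩
  have hL'' : W'.entireLFunction 1 ≠ 0 := by rw [hW'def]; exact hL'
  obtain ⟨g, hg⟩ := hnew W
  obtain ⟨g', hg'⟩ := hnew W'
  have hLW : ∀ m : ℕ, W.LFunction m = (if Even m then 0 else J(ds | m)) * V.LFunction m :=
    LFunction_member_eq V k hV hds hC
  have hLW' : ∀ m : ℕ, W'.LFunction m = J((m : ℤ) | (NumberField.discr K).natAbs) * W.LFunction m := by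
    rw [hW'def]; exact W.LFunction_quadraticTwist_apply_of_emod_four_eq_one hD4 hsqD hgoodW
  have hgε : ∀ m : ℕ, cuspCoeff g m = (((if Even m then 0 else J(ds | m) : ℤ)) : ℂ) * cuspCoeff f m := fun m => by
    rw [hg.2 m, hf.2 m, hLW m, Int.cast_mul]
  have hg'ε : ∀ m : ℕ, cuspCoeff g' m = (((if Even m then 0 else J(ds | m) : ℤ)) : ℂ) * cuspCoeff f' m := fun m => by
    rw [hg'.2 m, hLW' m, hLW m, hV'coef m, hκn m, hf.2 m]
    push_cast
    ring
  have hL0 : W.entireLFunction 1 = 0 := entireLFunction_one_eq_zero_of_analyticRank_eq_one hr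
  -- §E the tower `H = K(√d*)` and its sign character
  obtain ⟨H, hHf, hHn, hHa, hKH, t, htK, ht2⟩ :=
    exists_tower_sqrt hK hsplit (a := (ds : ℚ)) (by rcases hds with rfl | rfl | rfl <;> norm_num)
  have ht0 : t ≠ 0 := fun h => htK ⟨0, by rw [_root_.map_zero, h]⟩
  have htd : t ^ 2 = algebraMap K H (algebraMap ℚ K (ds : ℚ)) := sq_eq_algebraMap_tower ht2
  obtain ⟨G, χ, s, hG, hs, hsign⟩ := exists_relGal_signCharacter htd ht0
  obtain ⟨τ, hτK, hτt⟩ := exists_algEquiv_tower hKH htK htd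
  obtain ⟨hτG, hsτ⟩ := mem_and_sign_of_apply_eq_neg ht0 hG hsign τ hτK hτt
  have hGK : ∀ (σ : G) (a : K), σ.1 (algebraMap K H a) = algebraMap K H a := fun σ => (hG σ.1).mp σ.2
  -- §F `u = √d_K`, the conjugation
  obtain ⟨u, hu, hue⟩ := exists_sqrt_discr hK
  obtain ⟨cc, hcu⟩ := exists_algEquiv_neg_sqrt h2K hu hue
  -- §G Mordell–Weil: a generator of `V^{(d*)}(ℚ) ≅ W(ℚ)` modulo torsion; the companion twist is torsion
  have hrkW : W.mordellWeilRank = 1 := by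
    have h := (hrank W (by rw [hr])).1
    rw [h, hr]
  have hrk : (V.quadraticTwist (ds : ℚ)).mordellWeilRank = 1 := by
    have e : (V.quadraticTwist (ds : ℚ)).mordellWeilRank = W.mordellWeilRank := by
      rw [← hC]; exact @VariableChange.finrank_point_variableChange ℚ _ W C (Classical.decEq ℚ)
    rw [e, hrkW]
  obtain ⟨P, hP, hgen⟩ := exists_generator_modTorsion_of_mordellWeilRank_eq_one (V.quadraticTwist (ds : ℚ)) hrk
  obtain ⟨C'', hC''⟩ := exists_smul_quadraticTwist_of_smul_eq hC ((NumberField.discr K : ℤ) : ℚ)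
  rw [← hW'def] at hC''
  have hW'r : W'.analyticRank = 0 := (W'.analyticRank_eq_zero_iff_holds (hmod W')).mpr hL''
  have hW'rk : W'.mordellWeilRank = 0 := by
    have h := (hrank W' (by rw [hW'r]; exact zero_le_one)).1
    rw [h, hW'r]
  have htors := forall_isOfFinAddOrder_of_smul_eq W' C'' hC'' (isOfFinAddOrder_of_mordellWeilRank_eq_zero W' hW'rk)
  -- §H assemble (staged, to keep each unification shallow)
  refine ⟨K, hKf, hKn, hKg, hK, h2K, hsplit, 𝔭, 𝔭', h𝔭, h𝔭', hne, κ, hκ, hκ2, hcop, ?_⟩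
  refine ⟨k, V, V', hVell, hVmin, hV'ell, hV'min, C₁, hV, rfl, hC₁, hordV, hordV', hap, hgoodV, ?_⟩
  refine ⟨V.conductorNorm ℤ, V'.conductorNorm ℤ, hVN, hV'N, f, f', hf, hf', hV'coef, hnp V, ?_⟩
  refine ⟨W.conductorNorm ℤ, W'.conductorNorm ℤ, hWN, hW'N, g, g', W', hW'ell, hg, hg', hgε, hg'ε, hL'', hL0, ?_⟩
  refine ⟨H, hHf, hHn, hHa, hKH, t, htK, ht2, G, χ, s, hs, hGK, τ, hτG, hsτ, hτK, hτt, ?_⟩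
  refine ⟨u, ((NumberField.discr K : ℤ) : ℚ), hu, hue, cc, hcu, hVds, C, hC, P, ?_, ?_, ?_⟩
  -- (the `DecidableEq ℚ` instance inside `E(ℚ)`'s group law: classical in the Mordell–Weil lemmas, computable here;
  -- they agree by subsingleton elimination)
  · convert hP
  · convert hgen
  · convert htors

end Summit.BirchSwinnertonDyer.BirchSwinnertonDyer.Theorems.PrintCf2.DisegniPairTwo

end
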